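import Literature.Probability.Percolation.StaticRenormalizationTwoArms
import Literature.Probability.Percolation.UniquenessZone
import HarnessLib

/-!
# `stub_supercritBadPairDecay` of line `registered` (crux `LinearScaleLROOfTheta`,
# stmt-CriticalPhenomena-0855): supercritical pairwise uniqueness at linear scale

Registered stub of the lead's skeleton for the crux
`Summit.CriticalPhenomena.PercolationContinuityZ3.Theses.PercFiniteBoxLRO.LinearScaleLROOfTheta`.

Statement: for bond percolation on `ℤ³` and `p > p_c(ℤ³)`, for every `ε > 0` there is `N` such
that for all `n ≥ N` and all `x, y ∈ Λ_n`,
`P_p(x ↔ ∂Λ_{2n} in Λ_{2n}, y ↔ ∂Λ_{2n} in Λ_{2n}, x ↮ y in Λ_{2n}) ≤ ε`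
(the event `badPair (2 n) x y` of `UniquenessZone.lean`).

Source: Grimmett 1999, §7.4 Lemma (7.89) p. 186 (`P_p(E_{n,a}(x,y)) ≤ e^{-n(a-1)ξ}`), proved in
the tree as `Literature.Probability.Percolation.exists_twoArm_bound`
(`P_p(twoArm (n+1+K(2k+1)) x y) ≤ c^K` with `c < 1`, for `x, y ∈ Λ_n`, `d ≥ 3`, `p > p_c`).
The stub is its corollary via

* the inclusion `badPair R x y ⊆ twoArm R x y` for `x, y ∈ Λ_{R-1}` on lattice configurations
  `ω ⊆ E(ℤ³)` (`badPair_subset_twoArm`: the first exit from `Λ_{R-1}` of the arm to `∂Λ_R`,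
  exactly as in `boxArm_mono`; and `inConn ↑Λ_{R-1} x y ⊆ openConnIn ↑Λ_R x y`);
* the monotonicity `badPair_add_antitone` (`2n ≥ R = n+1+K(2k+1)` for `n ≥ K(2k+1)+1`);
* `DCT16.real_mono_of_forall_subset_edgeSet` to pass from inclusions valid on lattice
  configurations to inequalities of probabilities.
-/

noncomputable section

namespace Summit.CriticalPhenomena.PercolationContinuityZ3.Theorems

open Literature.Probability.Percolation Literature.Probability.LatticeModels MeasureTheory SimpleGraph

namespace LinearScaleLROSupercrit

/-- `{x ↔ ∂Λ_R in Λ_R} ⊆ {x ↔ ∂B(R)}` (`toBdry R x ⊆ boxArm R x`) for `x ∈ Λ_{R-1}`, `1 ≤ R`, on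
lattice configurations: stop the open path from `x` to `∂Λ_R` at its first exit from `Λ_{R-1}`
(the argument of `boxArm_mono`). -/
theorem boxArm_of_toBdry {R : ℕ} (hR : 1 ≤ R) {x : Site 3}
    (hx : x ∈ (↑(box 3 (R - 1)) : Set (Site 3))) {ω : BondConfig (Site 3)}
    (hω : ω ⊆ (zdGraph 3).edgeSet) (h : ω ∈ toBdry R x) : ω ∈ boxArm R x := by
  obtain ⟨w, hw, hpath⟩ := h
  -- the endpoint `w ∈ ∂Λ_R` lies outside `Λ_{R-1}`
  have hwR : w ∉ (↑(box 3 (R - 1)) : Set (Site 3)) := fun h' =>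
    DCT16.notMem_box_of_mem_innerBoundary_box (by omega) hw (Finset.mem_coe.1 h')
  have hxR : x ∈ (↑(box 3 R) : Set (Site 3)) :=
    Finset.mem_coe.2 (box_mono 3 (Nat.sub_le R 1) (Finset.mem_coe.1 hx))
  -- `{x ↔ w in Λ_R}` in the tree's sense is `{x ↔ w via withinGraph ℤ³ Λ_R}` on lattice configurations
  rw [openConnIn_eq_openConnVia hxR w] at hpath
  have hin : ω ∈ inConn (↑(box 3 R) : Set (Site 3)) x w := by
    change w ∈ openClusterIn (withinGraph (zdGraph 3) ↑(box 3 R)) ω x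
    rw [openClusterIn_withinGraph_eq_top (zdGraph 3) _ hω x]
    exact hpath
  -- an open lattice walk from `x` to `w`, and its first exit from `Λ_{R-1}`
  rw [mem_inConn_iff] at hin
  obtain ⟨W₀⟩ := hin
  have hle : openGraph ω ⊓ withinGraph (zdGraph 3) ↑(box 3 R) ≤ openGraph ω ⊓ zdGraph 3 :=
    inf_le_inf_left _ (withinGraph_le _ _)
  let W : (openGraph ω ⊓ zdGraph 3).Walk x w := W₀.mapLe hle
  obtain ⟨f, g, hf, hg, hfg, W', -, -, hW'⟩ :=
    exists_prefix_within_edges (↑(box 3 (R - 1))) W hx hwR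
  exact ⟨g, hg, f, hf, hfg, mem_inConn_of_walk_inf le_rfl W' hW'⟩

/-- `{x ↔ y in Λ_{R-1}}` (Grimmett's `inConn`, steps of `ℤ³` inside `Λ_{R-1}`) implies
`{x ↔ y in Λ_R}` in the tree's sense (`openConnIn`), for `x ∈ Λ_{R-1}`. -/
theorem openConnIn_of_inConn {R : ℕ} {x y : Site 3} (hx : x ∈ (↑(box 3 (R - 1)) : Set (Site 3)))
    {ω : BondConfig (Site 3)} (h : ω ∈ inConn (↑(box 3 (R - 1)) : Set (Site 3)) x y) :
    ω ∈ openConnIn (↑(box 3 R) : Set (Site 3)) x y := by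
  have hsub : (↑(box 3 (R - 1)) : Set (Site 3)) ⊆ ↑(box 3 R) :=
    Finset.coe_subset.2 (box_mono 3 (Nat.sub_le R 1))
  have hle : withinGraph (zdGraph 3) (↑(box 3 (R - 1)) : Set (Site 3)) ≤
      withinGraph ⊤ (↑(box 3 R) : Set (Site 3)) :=
    fun _ _ huv => ⟨huv.1.ne, hsub huv.2.1, hsub huv.2.2⟩
  rw [openConnIn_eq_openConnVia (hsub hx) y]
  exact openConnVia_mono_graph hle x y h

/-- **`badPair R x y ⊆ twoArm R x y`** for `x, y ∈ Λ_{R-1}`, `1 ≤ R`, on lattice configurations. -/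
theorem twoArm_of_badPair {R : ℕ} (hR : 1 ≤ R) {x y : Site 3}
    (hx : x ∈ (↑(box 3 (R - 1)) : Set (Site 3))) (hy : y ∈ (↑(box 3 (R - 1)) : Set (Site 3)))
    {ω : BondConfig (Site 3)} (hω : ω ⊆ (zdGraph 3).edgeSet) (h : ω ∈ badPair R x y) :
    ω ∈ twoArm R x y :=
  ⟨⟨boxArm_of_toBdry hR hx hω h.1.1, boxArm_of_toBdry hR hy hω h.1.2⟩,
    fun h' => h.2 (openConnIn_of_inConn hx h')⟩

/-- **`badPair (2n) x y ⊆ twoArm (n + 1 + L) x y`** for `x, y ∈ Λ_n` and `1 + L ≤ n`, on lattice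
configurations (`badPair_add_antitone` down from `2n` to `n + 1 + L`, then `twoArm_of_badPair`). -/
theorem twoArm_of_badPair_two_mul {n L : ℕ} (hL : 1 + L ≤ n) {x y : Site 3} (hx : x ∈ box 3 n)
    (hy : y ∈ box 3 n) {ω : BondConfig (Site 3)} (hω : ω ⊆ (zdGraph 3).edgeSet)
    (h : ω ∈ badPair (2 * n) x y) : ω ∈ twoArm (n + 1 + L) x y := by
  have h2 : ω ∈ badPair (n + n) x y := by rwa [two_mul] at h
  have h1 : ω ∈ badPair (n + (1 + L)) x y := badPair_add_antitone hx hy hω hL h2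
  rw [← Nat.add_assoc] at h1
  have hsub : box 3 n ⊆ box 3 (n + 1 + L - 1) := box_mono 3 (by omega)
  exact twoArm_of_badPair (by omega) (Finset.mem_coe.2 (hsub hx)) (Finset.mem_coe.2 (hsub hy)) hω h1

end LinearScaleLROSupercrit

open LinearScaleLROSupercrit in
/-- **Supercritical pairwise uniqueness at linear scale** (registered stub
`stub_supercritBadPairDecay` of crux `LinearScaleLROOfTheta`, stmt-CriticalPhenomena-0855). For
bond percolation on `ℤ³` and `p > p_c(ℤ³)`: for every `ε > 0` there is `N` such that for all
`n ≥ N` and all `x, y ∈ Λ_n`, `P_p(badPair (2n) x y) ≤ ε`. Corollary of Grimmett 1999 §7.4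
Lemma (7.89) (`exists_twoArm_bound`): `P_p(badPair (2n) x y) ≤ P_p(twoArm (n+1+K(2k+1)) x y) ≤ c^K < ε`. -/
theorem stub_supercritBadPairDecay :
    ∀ p : unitInterval, criticalProb (zdGraph 3) (0 : Site 3) < (p : ℝ) → ∀ ε : ℝ, 0 < ε →
      ∃ N : ℕ, ∀ n : ℕ, N ≤ n → ∀ x ∈ box 3 n, ∀ y ∈ box 3 n,
        (bondPercolation (zdGraph 3) p).real (badPair (2 * n) x y) ≤ ε := by
  intro p hp ε hε
  obtain ⟨k, -, c, -, hc1, hbound⟩ := exists_twoArm_bound (d := 3) (by norm_num) p hp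
  obtain ⟨K, hK⟩ := exists_pow_lt_of_lt_one hε hc1
  refine ⟨1 + K * (2 * k + 1), fun n hn x hx y hy => ?_⟩
  calc (bondPercolation (zdGraph 3) p).real (badPair (2 * n) x y)
      ≤ (bondPercolation (zdGraph 3) p).real (twoArm (n + 1 + K * (2 * k + 1)) x y) :=
        DCT16.real_mono_of_forall_subset_edgeSet (zdGraph 3) p fun ω hω h =>
          twoArm_of_badPair_two_mul hn hx hy hω h
    _ ≤ c ^ K := hbound n x y hx hy K
    _ ≤ ε := hK.le

end Summit.CriticalPhenomena.PercolationContinuityZ3.Theorems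

end
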